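import Mathlib
import Summits.ValiantsHypothesis.ValiantsHypothesis.Theorems.RigidityForcesSymmetryRankRigidMinimalReprLaplaceDefs
import Summits.ValiantsHypothesis.ValiantsHypothesis.Theorems.RigidityForcesSymmetryRankRigidMinimalReprLaplaceFiveSectorSplitDefs

/-!
# The Young-shadow SECTOR SPLIT of `LaplaceOptimalFive`: the two sectors are exactly the crux; two-split separation
# (crux `RankRigidMinimalRepr`, stmt-ValiantsHypothesis-18034; frontier rung `LaplaceOptimalFive`, stmt-24813; port of the
#  sorry-free part of crux idea #6 `young-shadow`, val-idea-19 g6, `Cruxes/LaplaceOptimalFive/YoungShadowSketch.lean`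
#  @03c74d92d6ab, per director-valiant g16 R282 (2)(d) — by-name infrastructure for the line `shallow_collision`)

Vocabulary from `…LaplaceFiveSectorSplitDefs.lean`.  Results (proofs verbatim from the sketch up to namespaces; the crux is
written as `LaplaceOptimal 5`, which is the route decl `…Theses.RigidityForcesSymmetry.LaplaceOptimalFive` by `Iff.rfl`):

* `laplaceOptimalFive_of_sectors : SideSymLaplaceOptimalFive → AsymLaplaceOptimalFive → LaplaceOptimal 5` and the converses
  `sideSym_of_laplaceOptimal_five`, `asym_of_laplaceOptimal_five` — the symmetric/asymmetric sector split is a genuine case split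
  of the crux, not a strengthening;
* `pair_cover` (kernel, `decide`): the two Young subgroups `S₂ × S₃` of two distinct pair splits generate `S₅`, effectively
  (every transposition is directly available or a conjugate of two available ones);
* `twoSplit_separation` (over `ℂ`): if `Z₁ + Z₂` is fully slot-symmetric and `Z_k` is symmetric within both sides of the pair
  split `S_k` (`S₁ ≠ S₂`), then each `Z_k` is fully symmetric — the smallest case of the idea's separation lemma.

HONEST FRAMING: a reformulation and one lemma; `LaplaceOptimalFive` (stmt-24813) is OPEN · CONTESTED 72/120 (on-shell case closed
by `LaplaceFiveOnShell.onShell_five`, p652503); `RankRigidMinimalRepr` does not move; `VP ≠ VNP` is NOT proved.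
-/

set_option autoImplicit false

-- the mandated summit-side namespace repeats a component by design (single-problem summit)
set_option linter.dupNamespace false

namespace Summit.ValiantsHypothesis.ValiantsHypothesis.Theorems.RigidityForcesSymmetryRankRigidMinimalRepr

namespace LaplaceFiveSectorSplit

open Finset

/-! ### §1 The sector split is the crux -/

/-- **COMPOSITION**: the two sectors together are exactly the crux `LaplaceOptimal 5` (`= LaplaceOptimalFive` by `Iff.rfl`). -/
theorem laplaceOptimalFive_of_sectors (h1 : SideSymLaplaceOptimalFive) (h2 : AsymLaplaceOptimalFive) : LaplaceOptimal 5 := by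
  intro N T S u w hu hw hsum
  by_cases hs : SideSymmetric T S u w
  · exact h1 N T S u w ⟨hu, hw, hsum⟩ hs
  · exact h2 N T S u w ⟨hu, hw, hsum⟩ hs

/-- HONESTY: K1 (the symmetric sector) is a consequence of the crux — a sector, not a strengthening. -/
theorem sideSym_of_laplaceOptimal_five (h : LaplaceOptimal 5) : SideSymLaplaceOptimalFive := by
  intro N T S u w hdec _
  exact h N T S u w hdec.1 hdec.2.1 hdec.2.2

/-- HONESTY: so is K2 (the asymmetric slice). -/
theorem asym_of_laplaceOptimal_five (h : LaplaceOptimal 5) : AsymLaplaceOptimalFive := by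
  intro N T S u w hdec _
  exact h N T S u w hdec.1 hdec.2.1 hdec.2.2

/-- The crux is EQUIVALENT to the conjunction of its two sectors. -/
theorem laplaceOptimal_five_iff_sectors : LaplaceOptimal 5 ↔ SideSymLaplaceOptimalFive ∧ AsymLaplaceOptimalFive :=
  ⟨fun h => ⟨sideSym_of_laplaceOptimal_five h, asym_of_laplaceOptimal_five h⟩,
    fun h => laplaceOptimalFive_of_sectors h.1 h.2⟩

/-! ### §2 Invariance under single slot permutations -/

/-- Invariance is closed under products. -/
theorem invUnder_mul {σ τ : Equiv.Perm (Fin 5)} {T : (Fin 5 → Fin 5) → ℂ} (hσ : InvUnder σ T) (hτ : InvUnder τ T) :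
    InvUnder (σ * τ) T := by
  intro v
  have h : v ∘ ⇑(σ * τ) = (v ∘ ⇑σ) ∘ ⇑τ := by
    funext i; simp [Equiv.Perm.coe_mul, Function.comp]
  rw [h, hτ, hσ]

/-- A swap of two slots of `A` preserves an `A`-slot-invariant tensor. -/
theorem invUnder_swap_of_mem {A : Finset (Fin 5)} {T : (Fin 5 → Fin 5) → ℂ} (h : SlotInvariantOn A T) {a b : Fin 5}
    (ha : a ∈ A) (hb : b ∈ A) : InvUnder (Equiv.swap a b) T := by
  intro v
  exact h (Equiv.swap a b) (fun i hi => Equiv.swap_apply_of_ne_of_ne (fun h' => hi (h' ▸ ha)) (fun h' => hi (h' ▸ hb))) v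

/-- A swap of two slots outside `A` preserves an `Aᶜ`-slot-invariant tensor. -/
theorem invUnder_swap_of_not_mem {A : Finset (Fin 5)} {T : (Fin 5 → Fin 5) → ℂ} (h : SlotInvariantOn Aᶜ T) {a b : Fin 5}
    (ha : a ∉ A) (hb : b ∉ A) : InvUnder (Equiv.swap a b) T :=
  invUnder_swap_of_mem h (Finset.mem_compl.mpr ha) (Finset.mem_compl.mpr hb)

/-- If `T₁ + T₂` and `T₁` are invariant, so is `T₂`. -/
theorem invUnder_of_add_left {τ : Equiv.Perm (Fin 5)} {T₁ T₂ : (Fin 5 → Fin 5) → ℂ} (h12 : InvUnder τ (T₁ + T₂))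
    (h1 : InvUnder τ T₁) : InvUnder τ T₂ := by
  intro v
  have h := h12 v
  simp only [Pi.add_apply] at h
  rw [h1 v] at h
  linear_combination h

/-- If `T₁ + T₂` and `T₂` are invariant, so is `T₁`. -/
theorem invUnder_of_add_right {τ : Equiv.Perm (Fin 5)} {T₁ T₂ : (Fin 5 → Fin 5) → ℂ} (h12 : InvUnder τ (T₁ + T₂))
    (h2 : InvUnder τ T₂) : InvUnder τ T₁ := by
  intro v
  have h := h12 v
  simp only [Pi.add_apply] at h
  rw [h2 v] at h
  linear_combination h

/-- Reading of the Boolean availability test. -/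
theorem avP_of_av {p q r s x y : Fin 5} (h : av p q r s x y = true) : AvP p q r s x y := by
  unfold av at h
  unfold AvP
  exact of_decide_eq_true h

/-! ### §3 Two-split separation -/

/-- COMBINATORIAL CORE (kernel, `decide`): for two distinct pair splits every transposition of the five slots is directly
available or a conjugate `(c x)(y c)(c x) = (x y)` of two directly available ones — i.e. the two Young subgroups `S₂ × S₃`
generate `S₅` (maximality), in the effective form the separation proof uses. -/
theorem pair_cover : ∀ p q r s : Fin 5, p ≠ q → r ≠ s → ¬((p = r ∧ q = s) ∨ (p = s ∧ q = r)) →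
    ∀ x y : Fin 5, x ≠ y → av p q r s x y = true ∨
      ∃ c : Fin 5, c ≠ x ∧ c ≠ y ∧ av p q r s x c = true ∧ av p q r s c y = true := by
  decide

/-- **TWO-SPLIT SEPARATION** (over `ℂ`; the idea's first lemma in its smallest case): if `Z₁ + Z₂` is fully slot-symmetric and
`Z_k` is symmetric within both sides of the pair split `S_k` (`S₁ ≠ S₂`), then each `Z_k` is fully symmetric — the Young shadows of
an exact side-symmetric decomposition on two splits are symmetric tensors (polynomials), whence catalecticant bounds. -/
theorem twoSplit_separation (S₁ S₂ : Finset (Fin 5)) (h₁ : S₁.card = 2) (h₂ : S₂.card = 2) (h12 : S₁ ≠ S₂)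
    (Z₁ Z₂ : (Fin 5 → Fin 5) → ℂ)
    (hZ₁ : SlotInvariantOn S₁ Z₁ ∧ SlotInvariantOn S₁ᶜ Z₁) (hZ₂ : SlotInvariantOn S₂ Z₂ ∧ SlotInvariantOn S₂ᶜ Z₂)
    (hsum : SlotInvariantOn Finset.univ (Z₁ + Z₂)) :
    SlotInvariantOn Finset.univ Z₁ ∧ SlotInvariantOn Finset.univ Z₂ := by
  obtain ⟨p, q, hpq, rfl⟩ := Finset.card_eq_two.mp h₁
  obtain ⟨r, s, hrs, rfl⟩ := Finset.card_eq_two.mp h₂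
  have hne : ¬((p = r ∧ q = s) ∨ (p = s ∧ q = r)) := by
    rintro (⟨rfl, rfl⟩ | ⟨rfl, rfl⟩)
    · exact h12 rfl
    · exact h12 (Finset.pair_comm p q)
  have hfull : ∀ τ : Equiv.Perm (Fin 5), InvUnder τ (Z₁ + Z₂) :=
    fun τ v => hsum τ (fun i hi => absurd (Finset.mem_univ i) hi) v
  have mem_pair : ∀ {a b x : Fin 5}, (x = a ∨ x = b) → x ∈ ({a, b} : Finset (Fin 5)) := by
    intro a b x hx
    rcases hx with rfl | rfl <;> simp
  have not_mem_pair : ∀ {a b x : Fin 5}, ¬(x = a ∨ x = b) → x ∉ ({a, b} : Finset (Fin 5)) := by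
    intro a b x hx h
    simp only [Finset.mem_insert, Finset.mem_singleton] at h
    exact hx h
  have hAv : ∀ x y : Fin 5, av p q r s x y = true → InvUnder (Equiv.swap x y) Z₂ := by
    intro x y hxy
    rcases avP_of_av hxy with h | h | h | h
    · exact invUnder_of_add_left (hfull _) (invUnder_swap_of_mem hZ₁.1 (mem_pair h.1) (mem_pair h.2))
    · exact invUnder_of_add_left (hfull _) (invUnder_swap_of_not_mem hZ₁.2 (not_mem_pair h.1) (not_mem_pair h.2))
    · exact invUnder_swap_of_mem hZ₂.1 (mem_pair h.1) (mem_pair h.2)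
    · exact invUnder_swap_of_not_mem hZ₂.2 (not_mem_pair h.1) (not_mem_pair h.2)
  have hswap : ∀ x y : Fin 5, x ≠ y → InvUnder (Equiv.swap x y) Z₂ := by
    intro x y hxy
    rcases pair_cover p q r s hpq hrs hne x y hxy with h | ⟨c, hcx, hcy, hxc, hcy'⟩
    · exact hAv x y h
    · -- `swap c x * swap y c * swap c x = swap x y`
      have key : Equiv.swap c x * Equiv.swap y c * Equiv.swap c x = Equiv.swap x y :=
        Equiv.swap_mul_swap_mul_swap (x := y) (y := c) (z := x) (fun h => hcy h.symm) (fun h => hxy h.symm)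
      have h1 : InvUnder (Equiv.swap c x) Z₂ := by rw [Equiv.swap_comm]; exact hAv x c hxc
      have h2 : InvUnder (Equiv.swap y c) Z₂ := by rw [Equiv.swap_comm]; exact hAv c y hcy'
      rw [← key]
      exact invUnder_mul (invUnder_mul h1 h2) h1
  have hZ₂full : ∀ τ : Equiv.Perm (Fin 5), InvUnder τ Z₂ := by
    intro τ
    induction τ using Equiv.Perm.swap_induction_on with
    | one => intro v; simp
    | swap_mul f x y hxy ih => exact invUnder_mul (hswap x y hxy) ih
  refine ⟨fun τ _ v => ?_, fun τ _ v => hZ₂full τ v⟩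
  exact invUnder_of_add_right (hfull τ) (hZ₂full τ) v

end LaplaceFiveSectorSplit

end Summit.ValiantsHypothesis.ValiantsHypothesis.Theorems.RigidityForcesSymmetryRankRigidMinimalRepr
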